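import Summits.CriticalPhenomena.CardyFormulaZ2.Theorems.CardySelfDualSegmentUniformMarginalityDefs

/-!
# The crux `UniformMarginality` is equicontinuity of the crossing curves (line `Sketch`, stmt-CriticalPhenomena-5472)

Reformulation lemmas of the lead's line (no new definition, no named fact): with
`F_R δ t := Pext R δ t = P_t(R, δ)` viewed as the family, indexed by the mesh `δ > 0` (`δ : Set.Ioi 0`),
of curves on the parameter interval (`t : Set.Icc 0 1`) — written out in every statement, nothing is defined —

* `integratedBound_iff_equicontinuous` — the line's `IntegratedBound` (a modulus of continuity in `t`
  at every `t₀`, uniform in the mesh) is LITERALLY `∀ R, Equicontinuous (F_R)` (Mathlib's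
  `Equicontinuous` on the compact parameter interval, `Metric.equicontinuousAt_iff`);
* `integratedBound_iff_uniformEquicontinuous` — equivalently UNIFORM equicontinuity on `[0,1]`
  (Heine–Cantor for families, `CompactSpace.uniformEquicontinuous_of_equicontinuous`), i.e. ONE
  `η(R, ε)` serving every `t₀` — the form the route's `SegmentClosed`/`ContinuitySweep` consume;
* `uniformMarginality_iff_equicontinuous` — hence the crux decl itself:
  `UniformMarginality ↔ ∀ R, Equicontinuous (F_R)` (through the landed
  `uniformMarginality_of_integratedBound` and its converse, re-proved here in three lines).

By Arzelà–Ascoli (values in `[0,1]`) this says: the crux holds iff for every conformal rectangle the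
curves `t ↦ P_t(R,δ)` are relatively compact in `C([0,1])` as `δ → 0⁺` — every subsequential scaling
limit of the segment's crossing probabilities is a UNIFORM limit and a continuous function of `t`.
-/

noncomputable section

namespace Summit.CriticalPhenomena.CardyFormulaZ2.Cruxes.UniformMarginality.HeatFlow

open Literature.Probability.Percolation Literature.Probability.LatticeModels
  Literature.Probability.RandomPlanarGeometry
open scoped Topology

/-- **`IntegratedBound` is equicontinuity of the crossing curves**, rectangle by rectangle. -/
theorem integratedBound_iff_equicontinuous :
    IntegratedBound ↔ ∀ R : ConformalRectangle, Equicontinuous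
        (fun (δ : Set.Ioi (0 : ℝ)) (t : Set.Icc (0 : ℝ) 1) => Pext R (δ : ℝ) (t : ℝ)) := by
  constructor
  · intro h R t₀
    rw [Metric.equicontinuousAt_iff]
    intro ε hε
    obtain ⟨η, hη, hmain⟩ := h R (t₀ : ℝ) t₀.2 ε hε
    refine ⟨η, hη, fun t ht δ => ?_⟩
    rw [Real.dist_eq, abs_sub_comm]
    exact hmain (δ : ℝ) δ.2 (t : ℝ) t.2 (by rwa [Subtype.dist_eq, Real.dist_eq] at ht)
  · intro h R t₀ ht₀ ε hε
    have key := Metric.equicontinuousAt_iff.1 (h R ⟨t₀, ht₀⟩) ε hε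
    obtain ⟨η, hη, hmain⟩ := key
    refine ⟨η, hη, fun δ hδ t ht htt₀ => ?_⟩
    have := hmain ⟨t, ht⟩ (by rw [Subtype.dist_eq, Real.dist_eq]; exact htt₀) ⟨δ, hδ⟩
    rw [Real.dist_eq, abs_sub_comm] at this
    exact this

/-- **Equivalently, UNIFORM equicontinuity on `[0,1]`** (one `η(R, ε)` for all `t₀`): the parameter
interval is compact (Heine–Cantor for equicontinuous families). -/
theorem integratedBound_iff_uniformEquicontinuous :
    IntegratedBound ↔ ∀ R : ConformalRectangle, UniformEquicontinuous
        (fun (δ : Set.Ioi (0 : ℝ)) (t : Set.Icc (0 : ℝ) 1) => Pext R (δ : ℝ) (t : ℝ)) := by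
  rw [integratedBound_iff_equicontinuous]
  exact forall_congr' fun R =>
    ⟨CompactSpace.uniformEquicontinuous_of_equicontinuous, UniformEquicontinuous.equicontinuous⟩

/-- The uniform form unfolded: `IntegratedBound` iff for every `R` and `ε > 0` ONE `η > 0` gives
`|P_t(R,δ) − P_s(R,δ)| < ε` for all meshes `δ > 0` and all `s, t ∈ [0,1]` with `|t − s| < η`. -/
theorem integratedBound_iff_uniform :
    IntegratedBound ↔ ∀ R : ConformalRectangle, ∀ ε > 0, ∃ η > 0, ∀ δ : ℝ, 0 < δ →
      ∀ s ∈ Set.Icc (0 : ℝ) 1, ∀ t ∈ Set.Icc (0 : ℝ) 1, |t - s| < η →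
        |Pext R δ t - Pext R δ s| < ε := by
  rw [integratedBound_iff_uniformEquicontinuous]
  refine forall_congr' fun R => ?_
  rw [Metric.uniformEquicontinuous_iff]
  constructor
  · intro h ε hε
    obtain ⟨η, hη, hmain⟩ := h ε hε
    refine ⟨η, hη, fun δ hδ s hs t ht hts => ?_⟩
    have := hmain ⟨s, hs⟩ ⟨t, ht⟩ (by rw [Subtype.dist_eq, Real.dist_eq, abs_sub_comm]; exact hts) ⟨δ, hδ⟩
    rw [Real.dist_eq, abs_sub_comm] at this
    exact this
  · intro h ε hε
    obtain ⟨η, hη, hmain⟩ := h ε hε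
    refine ⟨η, hη, fun s t hst δ => ?_⟩
    rw [Real.dist_eq, abs_sub_comm]
    exact hmain (δ : ℝ) δ.2 (s : ℝ) s.2 (t : ℝ) t.2
      (by rw [Subtype.dist_eq, Real.dist_eq, abs_sub_comm] at hst; exact hst)

/-- The crux implies `IntegratedBound` (converse of the landed `uniformMarginality_of_integratedBound`;
also landed by the disprover as `Negative.integratedBound_of_uniformMarginality` — three lines, repeated
to keep this file's imports to the Defs file). -/
theorem integratedBound_of_crux
    (h : Summit.CriticalPhenomena.CardyFormulaZ2.Theses.CardySelfDualSegment.UniformMarginality) :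
    IntegratedBound := by
  intro R t₀ ht₀ ε hε
  obtain ⟨η, hη, hmain⟩ := h ⟨t₀, ht₀⟩ R ε hε
  refine ⟨η, hη, fun δ hδ t ht htt₀ => ?_⟩
  have key := hmain ⟨t, ht⟩ (by rw [Subtype.dist_eq, Real.dist_eq]; exact htt₀) δ hδ
  have e1 : Pext R δ t = cornerCrossingProb ⟨t, ht⟩ R δ := Pext_coe R δ ⟨t, ht⟩
  have e2 : Pext R δ t₀ = cornerCrossingProb ⟨t₀, ht₀⟩ R δ := Pext_coe R δ ⟨t₀, ht₀⟩
  rw [e1, e2]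
  exact key

/-- **The crux `UniformMarginality` is, literally, equicontinuity on `[0,1]` of the crossing curves
`t ↦ P_t(R,δ)`, `δ > 0`, for every conformal rectangle `R`.** -/
theorem uniformMarginality_iff_equicontinuous :
    Summit.CriticalPhenomena.CardyFormulaZ2.Theses.CardySelfDualSegment.UniformMarginality ↔
      ∀ R : ConformalRectangle, Equicontinuous
        (fun (δ : Set.Ioi (0 : ℝ)) (t : Set.Icc (0 : ℝ) 1) => Pext R (δ : ℝ) (t : ℝ)) :=
  ⟨fun h => integratedBound_iff_equicontinuous.1 (integratedBound_of_crux h),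
   fun h => uniformMarginality_of_integratedBound (integratedBound_iff_equicontinuous.2 h)⟩

/-- … and therefore UNIFORM equicontinuity on `[0,1]`: under the crux one `η(R, ε)` serves every `t₀`. -/
theorem uniformMarginality_iff_uniformEquicontinuous :
    Summit.CriticalPhenomena.CardyFormulaZ2.Theses.CardySelfDualSegment.UniformMarginality ↔
      ∀ R : ConformalRectangle, UniformEquicontinuous
        (fun (δ : Set.Ioi (0 : ℝ)) (t : Set.Icc (0 : ℝ) 1) => Pext R (δ : ℝ) (t : ℝ)) :=
  uniformMarginality_iff_equicontinuous.trans
    (integratedBound_iff_equicontinuous.symm.trans integratedBound_iff_uniformEquicontinuous)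

end Summit.CriticalPhenomena.CardyFormulaZ2.Cruxes.UniformMarginality.HeatFlow

end
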